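import Summits.ABC.IUTFork.LDHGenuineStepVBound
import Summits.ABC.IUTFork.Cor312ProvenancePointJ
import Literature.IUT.LogVolume.GenuineLogThetaPoint
import Literature.IUT.LogVolume.PilotSlotResidue
import HarnessLib

/-!
# The fork at [IUTchIII] Corollary 3.12, L-DH level: [IUTchIV] Thm. 1.10 Step (v) AT THE Θ-DATA OF A DEGREE-ONE
# POINT — `d_mod = 1` forces slot-constancy, so (V) holds for every genuine datum (abc-iut cell, crux ThetaPartII =
# stmt-ABC-19678, child (ii′) `stub_hullVolume`; support S-a at `[F_mod : ℚ] = 1`, the "d = 1 cut")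

Record-only file (D-0012) of the abc-iut cell (WAVE-3 discharge seat abc-iut-c312-d1, gen 4); TAKES NO SIDE.
Mochizuki, *Inter-universal Teichmüller theory IV* (RIMS ms Apr. 2020 = PRIMS **57** (2021)), Thm. 1.10 p. 22
("`d_mod := [F_mod : ℚ]`"), proof Step (v) pp. 27–29; Cor. 2.2 (ii) proof p. 46 ("`F_mod` for the minimal field of
definition of the corresponding point `∈ M_ell(ℚ̄)`", p. 42).

For a genuine Θ-volume datum `T : Cor22.ThetaVolumeDatumAt P l` (abc-iut-S2/w4-d037, model reading v3: a curve
`E_F` over `F ⊇ F_tpd` with `j(E_F) = j(λ)`, initial Θ-data `D`, input `I` over `F_mod = fieldOfModuli E_F = ℚ(j(E_F))`):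
* `finrank_fieldOfModuli_eq_dmod` — `[F_mod : ℚ] = Cor22.dmod P` (abc-iut-c312-8's `Cor312Prov.dmod_eq_of_j_extend`
  read on the datum's `j_eq`);
* `slotConstant_of_dmod_eq_one` — at a point with `d_mod = 1` (e.g. `λ ∈ ℚ`) every support prime has ONE place of
  `F_mod` over it, so the canonical `log(q_v)` is slot-constant on every collection: the hypothesis `hconst` of
  abc-iut-c312-d1's `DHData.hullEstimateOf_ofInput_stepV…` DISCHARGED (regime (a) of plan/c312/STEPV-IND1-NOTE.md);
* `slotResidue_eq_zero_of_dmod_eq_one` — abc-iut-S8's slot residue of the datum vanishes (`PilotSlotResidue`);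
* **`hullEstimateOf_stepV_at_of_dmod_eq_one`** — (V) for EVERY genuine datum at a degree-one point, from the
  (R4)-shape tameness input (abc-iut-S1's `ι`-form) and a bound `dK` of the different sum alone:
  `T.HullEstimateOf ((l+1)/4·{(1+4/l)·dK + (4/l)·Σ_{p∈T(I)} log p + (20/3)·log(e*_mod·l)·π(e*_mod·l)})` — the input of
  abc-iut-S3's `Cor22.deltaK_le_BIII`, hence of child (ii′) with the constant `B_III(P,l)`, with NO Step-(v) residue.
[cite: Mochizuki2012, IUTchIV Thm. 1.10 p. 22, proof Step (v) p. 27–29] [cite: Mochizuki2012, IUTchIV Cor. 2.2 (ii)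
proof p. 42, 46] [claim: Mochizuki2012, status: disputed] for every IUT quotation. HONEST SCOPE: nothing asserts
[IUTchIII] Cor. 3.12 or the existence of a datum; `d_mod = 1` is a hypothesis on the point.
-/

noncomputable section

namespace Summit.ABC.IUTFork

namespace PointStepV

open Literature.IUT.LogVolume Literature.IUT.HodgeTheaters NumberField IsDedekindDomain
open Literature.NumberTheory.DiophantineGeometry.GenEll

variable {P : NFPoint} {l : ℕ}

/-- **`[F_mod : ℚ] = d_mod(P)`** for the field of moduli of the datum's curve (`j(E_F) = j(λ)`: abc-iut-c312-8's
`Cor312Prov.dmod_eq_of_j_extend`). [cite: Mochizuki2012, IUTchIV Thm. 1.10 p. 22] -/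
theorem finrank_fieldOfModuli_eq_dmod (T : Cor22.ThetaVolumeDatumAt P l) :
    (letI := T.instFieldF; letI := T.instNumberFieldF; letI := T.instAlgebraF; letI := T.instIsElliptic
     Module.finrank ℚ (fieldOfModuli T.E)) = Cor22.dmod P := by
  letI := T.instFieldF; letI := T.instNumberFieldF; letI := T.instAlgebraF; letI := T.instIsElliptic
  exact Cor312Prov.dmod_eq_of_j_extend T.j_eq

/-- **Slot-constancy at a degree-one point**: if `d_mod(P) = 1` then for every genuine datum `T` at `(P, l)` the
canonical `log(q_v)` takes one value on the places of `F_mod` over each support prime (there is only one place) —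
the hypothesis `hconst` of `DHData.hullEstimateOf_ofInput_stepV…`. [cite: Mochizuki2012, IUTchIV Thm. 1.10 proof Step (v) p. 27–28] -/
theorem slotConstant_of_dmod_eq_one (T : Cor22.ThetaVolumeDatumAt P l) (hd : Cor22.dmod P = 1) :
    letI := T.instFieldF; letI := T.instNumberFieldF; letI := T.instAlgebraF; letI := T.instIsElliptic
    letI := T.instFieldK; letI := T.instNumberFieldK; letI := T.instAlgebraK
    ∀ p ∈ T.I.supportPrimes, ∀ v w : placesOver (fieldOfModuli T.E) p,
      (DHData.ofInput T.I).logQloc p v = (DHData.ofInput T.I).logQloc p w := by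
  letI := T.instFieldF; letI := T.instNumberFieldF; letI := T.instAlgebraF; letI := T.instIsElliptic
  letI := T.instFieldK; letI := T.instNumberFieldK; letI := T.instAlgebraK
  intro p hp v w
  haveI : Fact p.Prime := ⟨T.I.prime_of_mem_supportPrimes hp⟩
  exact DHData.slotConstant_of_finrank_eq_one ((finrank_fieldOfModuli_eq_dmod T).trans hd) _ v w

/-- **The slot residue of a datum at a degree-one point vanishes** (abc-iut-S8's
`PilotData.slotResidue_eq_zero_of_finrank_eq_one`). [cite: DupuyHilado2025, §4.7] -/
theorem slotResidue_eq_zero_of_dmod_eq_one (T : Cor22.ThetaVolumeDatumAt P l) (hd : Cor22.dmod P = 1) :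
    (letI := T.instFieldF; letI := T.instNumberFieldF; letI := T.instAlgebraF; letI := T.instIsElliptic
     letI := T.instFieldK; letI := T.instNumberFieldK; letI := T.instAlgebraK
     T.I.X.slotResidue T.I.supportPrimes) = 0 := by
  letI := T.instFieldF; letI := T.instNumberFieldF; letI := T.instAlgebraF; letI := T.instIsElliptic
  letI := T.instFieldK; letI := T.instNumberFieldK; letI := T.instAlgebraK
  exact T.I.X.slotResidue_eq_zero_of_finrank_eq_one T.I.supportPrimes
    (fun p hp => T.I.prime_of_mem_supportPrimes hp) ((finrank_fieldOfModuli_eq_dmod T).trans hd)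

/-- **(V) for EVERY genuine Θ-volume datum at a degree-one point** (`d_mod(P) = 1`), from the (R4)-shape tameness
input at `e_mod` (abc-iut-S1's `ι`-form) and a bound `dK` of the different sum
`Σ_{p∈T(I)} (Σ_{v|p} n_v·d(K_{v̲}))/[F_mod:ℚ]·log p` (≤ `log(𝔡^K)`, `K/F_mod` Galois):
`T.HullEstimateOf ((l+1)/4·{(1+4/l)·dK + (4/l)·Σ_{p∈T(I)} log p + (20/3)·log(2^12·3^3·5·e_mod·l)·π(2^12·3^3·5·e_mod·l)})` —
the Step (v)–(viii) constant in the K-level currency of the junction, WITHOUT slot-constancy hypothesis and without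
residue. [cite: Mochizuki2012, IUTchIV Thm. 1.10 proof Steps (v)–(viii) p. 27–30] [claim: Mochizuki2012, status: disputed] -/
theorem hullEstimateOf_stepV_at_of_dmod_eq_one (T : Cor22.ThetaVolumeDatumAt P l) (hd : Cor22.dmod P = 1)
    (emod : ℕ) (hemod : 1 ≤ emod) {dK : ℝ}
    (hdK : letI := T.instFieldF; letI := T.instNumberFieldF; letI := T.instAlgebraF; letI := T.instIsElliptic
      letI := T.instFieldK; letI := T.instNumberFieldK; letI := T.instAlgebraK
      (∑ p ∈ T.I.supportPrimes, if hp : p.Prime then haveI : Fact p.Prime := ⟨hp⟩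
        (∑ v : placesOver (fieldOfModuli T.E) p, (localDegree (fieldOfModuli T.E) v.1 : ℝ) *
          differentOrd p ((T.I.σ.localFieldFamily p hp).k v)) / Module.finrank ℚ (fieldOfModuli T.E) * Real.log p
        else 0) ≤ dK)
    (hR4 : letI := T.instFieldF; letI := T.instNumberFieldF; letI := T.instAlgebraF; letI := T.instIsElliptic
      letI := T.instFieldK; letI := T.instNumberFieldK; letI := T.instAlgebraK
      ∀ (p : ℕ) [hp : Fact p.Prime], p ∈ T.I.supportPrimes → ∀ v : placesOver (fieldOfModuli T.E) p,
        p - 2 < absRamificationIdx p ((T.I.σ.localFieldFamily p hp.out).k v) →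
        3 + Real.log (absRamificationIdx p ((T.I.σ.localFieldFamily p hp.out).k v)) ≤
          4 * (if p ≤ 2 ^ 12 * 3 ^ 3 * 5 * emod * l then (1 : ℝ) else 0) *
            Real.log (((2 ^ 12 * 3 ^ 3 * 5 * emod : ℕ) : ℝ) * l)) :
    T.HullEstimateOf
      (((l : ℝ) + 1) / 4 * ((1 + 4 / (l : ℝ)) * dK
        + 4 / (l : ℝ) *
          (letI := T.instFieldF; letI := T.instNumberFieldF; letI := T.instAlgebraF; letI := T.instIsElliptic
           letI := T.instFieldK; letI := T.instNumberFieldK; letI := T.instAlgebraK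
           ∑ p ∈ T.I.supportPrimes, Real.log (p : ℝ))
        + 20 / 3 * Real.log ((2 : ℝ) ^ 12 * 3 ^ 3 * 5 * emod * l)
          * (Nat.primeCounting (2 ^ 12 * 3 ^ 3 * 5 * emod * l) : ℝ))) := by
  letI := T.instFieldF; letI := T.instNumberFieldF; letI := T.instAlgebraF; letI := T.instIsElliptic
  letI := T.instFieldK; letI := T.instNumberFieldK; letI := T.instAlgebraK
  exact DHData.hullEstimateOf_ofInput_stepV_of_iotaForm_pi T.I T.l_eq emod hemod hdK le_rfl hR4
    (slotConstant_of_dmod_eq_one T hd)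

end PointStepV

end Summit.ABC.IUTFork

end
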